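import Summits.BirchSwinnertonDyer.BirchSwinnertonDyer.Theorems.ResidualThetaTransportAtTwoOnePairSupplyDefs
import Summits.BirchSwinnertonDyer.BirchSwinnertonDyer.Theorems.ResidualThetaTransportAtTwoResidualSignedLambdaLowerCMAtTwoRelaxedDeepHalf
import HarnessLib

/-!
# ASSEMBLY clause C2 of the one-pair glue: the DEEP HALF `hDH` of the supply datum from the relaxed deep half (C1), (PERF₂) and the plus
# condition at `2` — Lemma A (`ann(L ⊓ E) = ann L + ann E`) run directly on `D₂ × D_{S₀}`

Route `ResidualThetaTransportAtTwo` (RTT), crux RSL_g `ResidualSignedLambdaLowerCMAtTwo` (stmt-BirchSwinnertonDyer-22608), line «onepair» (v3d),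
`Cruxes/ResidualSignedLambdaLowerCMAtTwo/ASSEMBLY-SPEC-g19.md` clause C2; LEAD `prover-bsd-wall-rtt-p2` g19 (`--supports 22608 --as helper`, closes
nothing). THEOREMS ONLY (no definition, no named fact, no instance, no `sorry`). BSD is not proved by any of this; RSL_g is OPEN.

WHAT. `RelaxedDeepHalf.deepHalfSigma_of_relaxed` (w2 g17: G1 coarsening + G2 split + (PERF₂)-lift over abstract `A`-linear carriers) RE-RUN DIRECTLY
on the carriers of the line, in the `ℤ₂`-currency of the registered texts with INTEGER slack and with every map an `AddMonoidHom` (the `A := ℤ` reading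
meets a `Module ℤ (CharacterModule _)` instance diamond — `CharacterModule.instModule ℤ` vs `AddCommGroup.toIntModule` — so the linear-map packaging
is not instantiated; only its one external input, Lemma A `CharIdealLambda.exists_character_add_of_vanish_inf_int`, is used). Data: the 2-side
coarsening `cN : 𝔉₂ →+ ℤ₂⟦X⟧ⁿ` (the assembly's `OnePairPins.colN`, abstract here: onto, `cN ∘ locd₂ = 𝒸`, and T1's kernel clause `hπker`), the
descended 2-side pairing `c̄₂ : ℤ₂⟦X⟧ⁿ →+ Sg⋆` with `c̄₂ (cN t) s = π₂.c₂ t (loc₂ s)` (S2's `pair₂` descended + w2's `pair₂_eq_c₂_locKer`), T1's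
`Eplus`/`hSg`/(PERF₂) `hperf`, and C1's conclusion `hDHrel` (`OnePair.hDHrel_of_pins`).

* `OnePair.deepHalf_of_pins` — for `t = (F, χ) ∈ ℤ₂⟦X⟧ⁿ × P_{S₀}` with `c̄₂ F s + ∑_w ∑ᶠ_c χ w c (locAway s w c) = 0` for all `s ∈ Sg`:
  `(m : ℤ₂) • t = (𝒸 x, locd_S x)` for some `m ∈ ℤ ∖ 0`, `x ∈ 𝐇¹` — the SUPPLY conjunct `hDH` (up to the cast `ℤ → ℤ₂`).

References: [MilneADT2006] Ch. I, Thm. 4.10 (b), Cor. 2.3; [Kobayashi2003] Thm. 7.3 ((7.17)–(7.21)); [Rubin2000] App. B §B.3.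
-/

set_option autoImplicit false
-- the Theorems namespace of this sub repeats the summit name by design (D-0017 nested layout)
set_option linter.dupNamespace false

noncomputable section

open scoped Classical

namespace Summit.BirchSwinnertonDyer.BirchSwinnertonDyer.Theorems.OnePair

open Literature.NumberTheory.EllipticCurves Literature.NumberTheory.EllipticCurves.GreenbergSelmer
open Literature.NumberTheory.GaloisRepresentations NumberField IsDedekindDomain Field
open Kobayashi2003 Rat.HeightOneSpectrum PowerSeries

variable {S : Set (PadicAlgCl 2)} {W : WeierstrassCurve ℚ} [W.IsElliptic] {κ : ZpExtension ℚ 2} {γ : absoluteGaloisGroup ℚ}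
  {S₀ : Finset (HeightOneSpectrum (𝓞 ℚ))} {n : ℕ} {ρ : FramedGaloisRep ℚ ↥(padicCoeffIntegers S) 2}
  {Θ : ∀ v : HeightOneSpectrum (𝓞 ℚ), ((2 : ℕ) : 𝓞 ℚ) ∈ v.asIdeal → (Cofree ρ ↥(padicCoeffField S) ≃+ (Fin n → ↥(W.geomPrimaryTorsion 2)))}
  {hΘ : ∀ v hv (δ : absoluteGaloisGroup (v.adicCompletion ℚ)) m i,
    Θ v hv (resGalOfEmb (closureEmb (K := ℚ) (v.adicCompletion ℚ)) δ • m) i = resGalOfEmb (closureEmb (K := ℚ) (v.adicCompletion ℚ)) δ • Θ v hv m i}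
  {I : Kato2004.IwasawaH1DataCoeff (FramedGaloisRep.toGaloisRep ρ) 2 κ γ}
  {Sg : AddSubgroup (subgroupH1 κ.kerSubgroup (Cofree ρ ↥(padicCoeffField S)))} [Module ↥(padicCoeffIntegers S) ↥Sg]
  (π : OnePairPins S W κ γ S₀ n ρ Θ hΘ I Sg) [Module ℤ_[2] (Dloc S κ ρ π.v)] (π₂ : AtTwoPins S κ ρ S₀ W γ n Θ hΘ I Sg π)
  [∀ w : ↥S₀, Module ℤ_[2] (Dloc S κ ρ (w : HeightOneSpectrum (𝓞 ℚ)))] (πₐ : AwayPins S κ ρ S₀ W γ n Θ hΘ I Sg π)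

-- the nested `∑ᶠ` character sums over the pinned structures exceed the default budget
set_option maxHeartbeats 800000 in
/-- **C2 — the deep half of the supply datum at the pins, integer slack.** Let `cN : 𝔉₂ →+ ℤ₂⟦X⟧ⁿ` be onto with `cN ∘ locd₂ = 𝒸` and T1's kernel
clause (`c₂ h` kills `E⁺` ⟹ `cN h = 0`), `c̄₂ : ℤ₂⟦X⟧ⁿ →+ Sg⋆` with `c̄₂ (cN t₀) s = π₂.c₂ t₀ (loc₂ s)`, `E⁺ ≤ D₂` with `Sg = {s ∈ SelRel | loc₂ s ∈ E⁺}`,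
(PERF₂) `π₂.c₂` onto, and the relaxed deep half `hDHrel` (C1). Then every `t = (F, χ)` with `c̄₂ F s + ∑_w ∑ᶠ_c χ w c (locAway s w c) = 0` on `Sg` satisfies
`(m : ℤ₂) • t = (𝒸 x, locd_S x)` for some `m ∈ ℤ ∖ 0`, `x ∈ 𝐇¹`. Proof: lift `F = cN t₀`; the relaxed character `Φ(y, d) = c₂ t₀ y + ∑∑ χ (d)` of
`D₂ × D_{S₀}` kills `loc(Sg) = loc(SelRel) ⊓ (E⁺ × ⊤)`, so `Φ = χ₁ + χ₂` with `χ₁|loc(SelRel) = 0`, `χ₂|E⁺ × ⊤ = 0` (Lemma A, injectivity of `ℚ/ℤ`); by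
(PERF₂) `χ₂ = Φ(h₂, 0)` with `cN h₂ = 0`; C1 applied to `(t₀ − h₂, χ)` and `cN` give the claim.
[cite: MilneADT2006, Ch. I, Thm. 4.10 (b), Cor. 2.3] [cite: Kobayashi2003, Thm. 7.3 ((7.17)–(7.21))] [cite: Rubin2000, App. B §B.3] -/
theorem deepHalf_of_pins
    (Eplus : AddSubgroup (Dloc S κ ρ π.v)) (hperf : Function.Surjective π₂.c₂)
    (hSg : ∀ s : subgroupH1 κ.kerSubgroup (Cofree ρ ↥(padicCoeffField S)), s ∈ Sg ↔ s ∈ selRelSubgroup S κ ρ S₀ ∧ locKer S κ ρ π.v s ∈ Eplus)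
    (cN : ((Fin n → ↥(Sprung2012.localTowerPointsOfEmb κ (closureEmb (K := ℚ) (π.v.adicCompletion ℚ)) W)) →+ ℤ_[2]) →+
      (Fin n → PowerSeries ℤ_[2]))
    (hcN : Function.Surjective cN)
    (hπker : ∀ h : (Fin n → ↥(Sprung2012.localTowerPointsOfEmb κ (closureEmb (K := ℚ) (π.v.adicCompletion ℚ)) W)) →+ ℤ_[2],
      (∀ e ∈ Eplus, π₂.c₂ h e = 0) → cN h = 0)
    (hcvec : ∀ x : I.H, cN (π.locd₂ x) = π.cvec x)
    (c2bar : (Fin n → PowerSeries ℤ_[2]) →+ CharacterModule ↥Sg)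
    (hc2bar : ∀ (t₀ : (Fin n → ↥(Sprung2012.localTowerPointsOfEmb κ (closureEmb (K := ℚ) (π.v.adicCompletion ℚ)) W)) →+ ℤ_[2]) (s : ↥Sg),
      c2bar (cN t₀) s = π₂.c₂ t₀ (locKer S κ ρ π.v (s : subgroupH1 κ.kerSubgroup (Cofree ρ ↥(padicCoeffField S)))))
    (hDHrel : ∀ t : ((Fin n → ↥(Sprung2012.localTowerPointsOfEmb κ (closureEmb (K := ℚ) (π.v.adicCompletion ℚ)) W)) →+ ℤ_[2]) × PAway S κ ρ S₀,
      (∀ s : subgroupH1 κ.kerSubgroup (Cofree ρ ↥(padicCoeffField S)), s ∈ selRelSubgroup S κ ρ S₀ →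
        π₂.c₂ t.1 (locKer S κ ρ π.v s) +
          ∑ w : ↥S₀, ∑ᶠ c : Cosets κ (w : HeightOneSpectrum (𝓞 ℚ)), t.2 w c (locAway S κ ρ S₀ s w c) = 0) →
      ∃ m : ℤ, m ≠ 0 ∧ ∃ x : I.H, (m : ℤ_[2]) • t = (π.locd₂ x, πₐ.locdS x))
    (t : (Fin n → PowerSeries ℤ_[2]) × PAway S κ ρ S₀)
    (ht : ∀ s : ↥Sg, c2bar t.1 s +
      ∑ w : ↥S₀, ∑ᶠ c : Cosets κ (w : HeightOneSpectrum (𝓞 ℚ)),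
        t.2 w c (locAway S κ ρ S₀ (s : subgroupH1 κ.kerSubgroup (Cofree ρ ↥(padicCoeffField S))) w c) = 0) :
    ∃ m : ℤ, m ≠ 0 ∧ ∃ x : I.H, (m : ℤ_[2]) • t = (π.cvec x, πₐ.locdS x) := by
  obtain ⟨F, χ⟩ := t
  obtain ⟨t₀, rfl⟩ := hcN F
  -- carriers: `D_{S₀} := Π_{w,c} D_w`, the S₀-side character `ψ d = ∑∑ χ w c (d w c)`, the localisation `loc s = (loc₂ s, (locAway s w c)_{w,c})`
  let DS : Type := ∀ w : ↥S₀, Cosets κ (w : HeightOneSpectrum (𝓞 ℚ)) → Dloc S κ ρ (w : HeightOneSpectrum (𝓞 ℚ))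
  have hfin : ∀ w : ↥S₀, Finite (Cosets κ (w : HeightOneSpectrum (𝓞 ℚ))) := fun w ↦ finite_cosets κ (w : HeightOneSpectrum (𝓞 ℚ))
  let ψ : DS →+ AddCircle (1 : ℚ) :=
    { toFun := fun d ↦ ∑ w : ↥S₀, ∑ᶠ c : Cosets κ (w : HeightOneSpectrum (𝓞 ℚ)), χ w c (d w c)
      map_zero' := Finset.sum_eq_zero fun w _ ↦ finsum_eq_zero_of_forall_eq_zero fun c ↦ by
        rw [Pi.zero_apply, Pi.zero_apply, map_zero]
      map_add' := fun d d' ↦ by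
        rw [← Finset.sum_add_distrib]
        refine Finset.sum_congr rfl fun w _ ↦ ?_
        haveI := hfin w
        rw [← finsum_add_distrib (Set.toFinite _) (Set.toFinite _)]
        exact finsum_congr fun c ↦ by rw [Pi.add_apply, Pi.add_apply, map_add] }
  have hψ : ∀ d : DS, ψ d = ∑ w : ↥S₀, ∑ᶠ c : Cosets κ (w : HeightOneSpectrum (𝓞 ℚ)), χ w c (d w c) := fun _ ↦ rfl
  -- the S₀-side localisation `s ↦ (locAway s w c)_{w,c}` as an additive map
  let locS : subgroupH1 κ.kerSubgroup (Cofree ρ ↥(padicCoeffField S)) →+ DS :=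
    { toFun := fun s w c ↦ locAway S κ ρ S₀ s w c
      map_zero' := funext fun w ↦ funext fun c ↦ by
        change locAway S κ ρ S₀ 0 w c = 0
        unfold locAway
        rw [map_zero, map_zero]
      map_add' := fun s s' ↦ funext fun w ↦ funext fun c ↦ by
        change locAway S κ ρ S₀ (s + s') w c = locAway S κ ρ S₀ s w c + locAway S κ ρ S₀ s' w c
        unfold locAway
        rw [map_add, map_add] }
  have hlocS : ∀ (s : subgroupH1 κ.kerSubgroup (Cofree ρ ↥(padicCoeffField S))) (w : ↥S₀) (c : Cosets κ (w : HeightOneSpectrum (𝓞 ℚ))),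
      locS s w c = locAway S κ ρ S₀ s w c := fun _ _ _ ↦ rfl
  -- the relaxed local character of `(t₀, χ)` on `D₂ × D_{S₀}`
  let Φ : CharacterModule (Dloc S κ ρ π.v × DS) :=
    AddMonoidHom.mk' (fun p ↦ π₂.c₂ t₀ p.1 + ψ p.2) fun p q ↦ by
      rw [Prod.fst_add, Prod.snd_add, map_add, map_add, add_add_add_comm]
  have hΦ : ∀ (y : Dloc S κ ρ π.v) (d : DS), Φ (y, d) = π₂.c₂ t₀ y + ψ d := fun _ _ ↦ rfl
  -- the two subgroups: `L := loc(SelRel)`, `E := E⁺ × ⊤` (as `ℤ`-submodules for Lemma A)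
  let L : Submodule ℤ (Dloc S κ ρ π.v × DS) :=
    ((((locKer S κ ρ π.v).prod locS).comp (selRelSubgroup S κ ρ S₀).subtype).range).toIntSubmodule
  let E : Submodule ℤ (Dloc S κ ρ π.v × DS) := (Eplus.prod ⊤).toIntSubmodule
  have hLmem : ∀ (s : subgroupH1 κ.kerSubgroup (Cofree ρ ↥(padicCoeffField S))), s ∈ selRelSubgroup S κ ρ S₀ →
      ((locKer S κ ρ π.v s, locS s) : Dloc S κ ρ π.v × DS) ∈ L := fun s hs ↦ by
    rw [← SetLike.mem_coe, AddSubgroup.coe_toIntSubmodule, SetLike.mem_coe, AddMonoidHom.mem_range]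
    exact ⟨⟨s, hs⟩, rfl⟩
  have hEmem : ∀ (y : Dloc S κ ρ π.v) (d : DS), y ∈ Eplus → ((y, d) : Dloc S κ ρ π.v × DS) ∈ E := fun y d hy ↦ by
    rw [← SetLike.mem_coe, AddSubgroup.coe_toIntSubmodule, SetLike.mem_coe, AddSubgroup.mem_prod]
    exact ⟨hy, AddSubgroup.mem_top _⟩
  -- `Φ` kills `L ⊓ E` (that is `loc(Sg)`): the hypothesis `ht` read through `hc2bar`
  have hΦLE : ∀ p ∈ L ⊓ E, Φ p = 0 := by
    intro p hp
    obtain ⟨hpL, hpE⟩ := Submodule.mem_inf.mp hp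
    rw [← SetLike.mem_coe, AddSubgroup.coe_toIntSubmodule, SetLike.mem_coe, AddMonoidHom.mem_range] at hpL
    obtain ⟨⟨s, hs⟩, rfl⟩ := hpL
    rw [← SetLike.mem_coe, AddSubgroup.coe_toIntSubmodule, SetLike.mem_coe, AddSubgroup.mem_prod] at hpE
    have hsg : s ∈ Sg := (hSg s).mpr ⟨hs, hpE.1⟩
    change π₂.c₂ t₀ (locKer S κ ρ π.v s) + ψ (locS s) = 0
    rw [← hc2bar t₀ ⟨s, hsg⟩, hψ]
    exact ht ⟨s, hsg⟩
  obtain ⟨χ₁, χ₂, h₁, h₂, hsum⟩ := CharIdealLambda.exists_character_add_of_vanish_inf_int L E Φ hΦLE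
  -- (PERF₂): `χ₂ = Φ(h₂, 0)` for some `h₂` with `cN h₂ = 0`
  have hχ₂ : ∀ (y : Dloc S κ ρ π.v) (d : DS), χ₂ (y, d) = χ₂ (y, 0) := fun y d ↦ by
    have h0 : χ₂ ((0 : Dloc S κ ρ π.v), d) = 0 := h₂ (0, d) (hEmem 0 d Eplus.zero_mem)
    have e : ((y, d) : Dloc S κ ρ π.v × DS) = (y, 0) + (0, d) := by ext <;> simp
    rw [e, map_add, h0, add_zero]
  -- the character `y ↦ χ₂ (y, 0)` of `D₂`
  let η : CharacterModule (Dloc S κ ρ π.v) :=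
    AddMonoidHom.mk' (fun y ↦ χ₂ (y, 0)) fun y y' ↦ by
      rw [← map_add, Prod.mk_add_mk, add_zero]
  have hη : ∀ y : Dloc S κ ρ π.v, η y = χ₂ (y, 0) := fun _ ↦ rfl
  obtain ⟨h₂', hh₂⟩ := hperf η
  have hker : cN h₂' = 0 := hπker h₂' fun e he ↦ by
    rw [hh₂, hη]
    exact h₂ (e, 0) (hEmem e 0 he)
  -- `(t₀ − h₂, χ)` is orthogonal to ALL of `SelRel`
  have ht' : ∀ s : subgroupH1 κ.kerSubgroup (Cofree ρ ↥(padicCoeffField S)), s ∈ selRelSubgroup S κ ρ S₀ →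
      π₂.c₂ (t₀ - h₂') (locKer S κ ρ π.v s) +
        ∑ w : ↥S₀, ∑ᶠ c : Cosets κ (w : HeightOneSpectrum (𝓞 ℚ)), χ w c (locAway S κ ρ S₀ s w c) = 0 := by
    intro s hs
    have hL : χ₁ (locKer S κ ρ π.v s, locS s) = 0 := h₁ _ (hLmem s hs)
    have hall : Φ (locKer S κ ρ π.v s, locS s) = χ₁ (locKer S κ ρ π.v s, locS s) + χ₂ (locKer S κ ρ π.v s, locS s) := by
      rw [hsum]; rfl
    rw [hL, zero_add, hχ₂, hΦ, hψ, ← hη, ← hh₂] at hall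
    simp only [hlocS] at hall
    rw [map_sub]
    change π₂.c₂ t₀ (locKer S κ ρ π.v s) - π₂.c₂ h₂' (locKer S κ ρ π.v s) +
      ∑ w : ↥S₀, ∑ᶠ c : Cosets κ (w : HeightOneSpectrum (𝓞 ℚ)), χ w c (locAway S κ ρ S₀ s w c) = 0
    rw [← hall]
    abel
  -- C1 on `(t₀ − h₂, χ)`, then push through `cN`
  obtain ⟨m, hm, x, hx⟩ := hDHrel (t₀ - h₂', χ) ht'
  refine ⟨m, hm, x, ?_⟩
  have hx1 : (m : ℤ_[2]) • (t₀ - h₂') = π.locd₂ x := congrArg Prod.fst hx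
  have hx2 : (m : ℤ_[2]) • χ = πₐ.locdS x := congrArg Prod.snd hx
  refine Prod.ext ?_ hx2
  change (m : ℤ_[2]) • cN t₀ = π.cvec x
  rw [← hcvec, ← hx1, Int.cast_smul_eq_zsmul, Int.cast_smul_eq_zsmul, map_zsmul, map_sub, hker, sub_zero]

end Summit.BirchSwinnertonDyer.BirchSwinnertonDyer.Theorems.OnePair

end
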